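import Summits.CriticalPhenomena.PercolationContinuityZ3.Theorems.PercNearOneGluingNoHeavyLowerTailQ44FibreFactorisation
import Summits.CriticalPhenomena.PercolationContinuityZ3.Theorems.PercNearOneGluingNoHeavyLowerTailTwoCopySupportedFibreBridge
import Summits.CriticalPhenomena.PercolationContinuityZ3.Theorems.PercNearOneGluingNoHeavyLowerTailQ44FibreBlockTables

/-!
# Law-level bridge for the vertex-cover class (generic kernel): fibre blocks are star tables and terminal-pair tables

Support file for crux `stmt-CriticalPhenomena-4575` (rows `W = 2·Q44`, `U`, `D_U`, `S3` for all `n`), seat `prim-bnk-1` gen 40;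
memo `run/shared/lean/prim/prim-l12/FROM-prim-bnk-1-gen40-FIBRE-BRIDGE.md`.  Step (iii) of the LAW-LEVEL FIBRE BRIDGE.

A weighted graph on `Fin n` with pairwise distinct marked points `a b c y` is in the VERTEX-COVER (VC) class if its weight vanishes on
every pair of non-terminal vertices.  In a supported two-copy fibre `(M, C)` of such a graph every pair is `v–q_k` (`v` internal) or
`q_k–q_k'`; labelling pairs by their internal end point (`vcBlk`) the blocks of `…Q44FibreFactorisation.fibre_factor` are STARS of
internal vertices (contracted terminals `A`, free terminals `F`) and single terminal pairs, and their tables are (definitions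
`glueCell`, `starTab`, `pairTab`, `vcBlk` in `…Q44FibreBlockTables`)
* `blockTab_star`: the star table `starTab A F (s,t) = #{S ⊆ F : glue(A ∪ S) = s, glue(A ∪ (F∖S)) = t}` (via `prof_star`);
* `blockTab_pair_free` / `blockTab_pair_contracted`: `pairTab k k'` (the `E`-operator; a free loop is `starTab ∅ {k}`) and
  `starTab {k,k'} ∅` (via `prof_pair`, `prof_empty`).
Hence **`sum_kernel_cell_nonneg_of_vertexCover`**: for ANY kernel `K` and any predicate `good` on tables such that good tables
acting on `K` give a nonnegative `(⊥,⊥)` entry (`VCCone.tactList_botbot_nonneg_*`), if all `starTab A F` (`A ∩ F = ∅`) and all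
`pairTab k k'` (`k ≠ k'`) are good then `0 ≤ Σ Kᵢⱼ cellᵢ cellⱼ` on every VC-class weighted graph, all `n`.  The instantiations
(`W` via the 81 certificates `…Q44TTConeStarOpsW`, then `U`, `D_U`, `S3`) are one-screen files `…Q44VertexCoverLaw{W,U,DU,S3}`.
No sorries, no named facts, NO definitions (those are in `…Q44FibreBlockTables`); standard axioms.
-/

namespace Summit.CriticalPhenomena.PercolationContinuityZ3.Theorems

namespace VCCone

open TwoCopyMono FourPointAtoms Literature.Probability.Percolation

variable {n : ℕ}

/-- A configuration whose terminal reachability is "equal or both in `X`" has cell `glueCell X`. [this work] -/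
theorem prof_eq_glueCell_of_iff (a b c y : Fin n) (ω : Set (Sym2 (Fin n))) (X : Finset (Fin 4))
    (h : ∀ k k' : Fin 4, (openGraph ω).Reachable (quad a b c y k) (quad a b c y k') ↔ (k = k' ∨ (k ∈ X ∧ k' ∈ X))) :
    prof a b c y ω = pp (glueCell X) := by
  funext k k'
  apply Bool.eq_iff_iff.2
  rw [prof_true_iff, h, pp_glueCell]

/-- The empty configuration has cell `⊥` (distinct terminals). [this work] -/
theorem prof_empty (a b c y : Fin n) (hq : Function.Injective (quad a b c y)) :
    prof a b c y (∅ : Set (Sym2 (Fin n))) = pp (glueCell ∅) := by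
  refine prof_eq_glueCell_of_iff a b c y ∅ ∅ fun k k' => ?_
  have h0 : openGraph (∅ : Set (Sym2 (Fin n))) = ⊥ := SimpleGraph.fromEdgeSet_empty
  rw [h0, SimpleGraph.reachable_bot, hq.eq_iff]
  simp

/-- `cellOf` of the empty configuration is `⊥ = 0` (distinct terminals). [this work] -/
theorem cellOf_empty (a b c y : Fin n) (hq : Function.Injective (quad a b c y)) :
    cellOf a b c y (↑(∅ : Finset (Sym2 (Fin n)))) = 0 := by
  rw [Finset.coe_empty, cellOf_eq_of_prof_eq (prof_empty a b c y hq)]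
  decide

/-- Every pair has two end points (representatives). [folklore] -/
theorem sym2_exists_eq (e : Sym2 (Fin n)) : ∃ u v : Fin n, e = s(u, v) :=
  Sym2.ind (fun u v => ⟨u, v, rfl⟩) e

/-- **Star at an internal vertex.**  The configuration `{v–q_k : k ∈ X}` (`v` not a terminal) has cell `glueCell X`. [this work] -/
theorem prof_star (a b c y : Fin n) (hq : Function.Injective (quad a b c y)) (v : Fin n)
    (hv : ∀ k, quad a b c y k ≠ v) (X : Finset (Fin 4)) :
    prof a b c y (↑(X.image fun k => s(v, quad a b c y k)) : Set (Sym2 (Fin n))) = pp (glueCell X) := by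
  classical
  set ω : Set (Sym2 (Fin n)) := ↑(X.image fun k => s(v, quad a b c y k)) with hω
  have hmem : ∀ e, e ∈ ω ↔ ∃ k ∈ X, s(v, quad a b c y k) = e := by
    intro e; rw [hω, Finset.mem_coe, Finset.mem_image]
  -- an end point of a star pair which is a terminal lies in `X`
  have hend : ∀ {k : Fin 4} {e : Sym2 (Fin n)}, e ∈ ω → quad a b c y k ∈ e → k ∈ X := by
    intro k e he hke
    obtain ⟨j, hj, rfl⟩ := (hmem e).1 he
    rcases Sym2.mem_iff.1 hke with h | h
    · exact absurd h (hv k)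
    · rw [hq h]; exact hj
  have hadj : ∀ {k : Fin 4}, k ∈ X → (openGraph ω).Adj (quad a b c y k) v := by
    intro k hk
    rw [openGraph_adj]
    exact ⟨(hmem _).2 ⟨k, hk, Sym2.eq_swap⟩, hv k⟩
  refine prof_eq_glueCell_of_iff a b c y ω X fun k k' => ⟨fun h => ?_, fun h => ?_⟩
  · by_cases hkk : k = k'
    · exact Or.inl hkk
    · right
      have hne : quad a b c y k ≠ quad a b c y k' := fun e => hkk (hq e)
      obtain ⟨e, he, hke⟩ := exists_mem_of_reachable_ne ω h hne
      obtain ⟨e', he', hke'⟩ := exists_mem_of_reachable_ne ω h.symm hne.symm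
      exact ⟨hend he' hke', hend he hke⟩
  · rcases h with h | ⟨hk, hk'⟩
    · rw [h]
    · exact (hadj hk).reachable.trans (hadj hk').reachable.symm

/-- **A terminal pair.**  The configuration `{q_k–q_k'}` has cell `glueCell {k, k'}` (`⊥` for a loop). [this work] -/
theorem prof_pair (a b c y : Fin n) (hq : Function.Injective (quad a b c y)) (k k' : Fin 4) :
    prof a b c y (↑({s(quad a b c y k, quad a b c y k')} : Finset (Sym2 (Fin n))) : Set (Sym2 (Fin n))) =
      pp (glueCell {k, k'}) := by
  classical
  set ω : Set (Sym2 (Fin n)) := ↑({s(quad a b c y k, quad a b c y k')} : Finset (Sym2 (Fin n))) with hω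
  have hmem : ∀ e, e ∈ ω ↔ e = s(quad a b c y k, quad a b c y k') := by
    intro e; rw [hω, Finset.coe_singleton, Set.mem_singleton_iff]
  have hend : ∀ {j : Fin 4} {e : Sym2 (Fin n)}, e ∈ ω → quad a b c y j ∈ e → j ∈ ({k, k'} : Finset (Fin 4)) := by
    intro j e he hje
    rw [(hmem e).1 he, Sym2.mem_iff] at hje
    rw [Finset.mem_insert, Finset.mem_singleton]
    rcases hje with h | h
    · exact Or.inl (hq h)
    · exact Or.inr (hq h)
  refine prof_eq_glueCell_of_iff a b c y ω {k, k'} fun i j => ⟨fun h => ?_, fun h => ?_⟩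
  · by_cases hij : i = j
    · exact Or.inl hij
    · right
      have hne : quad a b c y i ≠ quad a b c y j := fun e => hij (hq e)
      obtain ⟨e, he, hje⟩ := exists_mem_of_reachable_ne ω h hne
      obtain ⟨e', he', hie'⟩ := exists_mem_of_reachable_ne ω h.symm hne.symm
      exact ⟨hend he' hie', hend he hje⟩
  · rcases h with h | ⟨hi, hj⟩
    · rw [h]
    · by_cases hij : i = j
      · rw [hij]
      · have he : s(quad a b c y i, quad a b c y j) ∈ ω := by
          rw [hmem, Sym2.eq_iff]
          have hi' : i ∈ ({k, k'} : Finset (Fin 4)) := hi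
          have hj' : j ∈ ({k, k'} : Finset (Fin 4)) := hj
          rw [Finset.mem_insert, Finset.mem_singleton] at hi' hj'
          rcases hi' with rfl | rfl <;> rcases hj' with rfl | rfl
          · exact absurd rfl hij
          · exact Or.inl ⟨rfl, rfl⟩
          · exact Or.inr ⟨rfl, rfl⟩
          · exact absurd rfl hij
        exact SimpleGraph.Adj.reachable ((openGraph_adj _ _ _).2 ⟨he, fun e => hij (hq e)⟩)

/-- **The block of an internal vertex is a star table.**  For an internal vertex `v` with contracted terminals `A` and free
terminals `F`: `blockTab {v–q_k : k ∈ F} {v–q_k : k ∈ A} = starTab A F`. [this work] -/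
theorem blockTab_star (a b c y : Fin n) (hq : Function.Injective (quad a b c y)) (v : Fin n)
    (hv : ∀ k, quad a b c y k ≠ v) (A F : Finset (Fin 4)) :
    blockTab a b c y (F.image fun k => s(v, quad a b c y k)) (A.image fun k => s(v, quad a b c y k)) = starTab A F := by
  classical
  set f : Fin 4 → Sym2 (Fin n) := fun k => s(v, quad a b c y k) with hf
  have hfi : Function.Injective f := by
    intro k k' h
    rcases Sym2.eq_iff.1 h with ⟨_, h2⟩ | ⟨h1, _⟩
    · exact hq h2
    · exact absurd h1.symm (hv k')
  have hcell : ∀ X : Finset (Fin 4), cellOf a b c y ↑(X.image f) = glueCell X := fun X =>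
    cellOf_eq_of_prof_eq (prof_star a b c y hq v hv X)
  funext s t
  unfold blockTab starTab
  rw [Finset.powerset_image, Finset.filter_image, Finset.card_image_of_injective _ (Finset.image_injective hfi)]
  congr 1
  refine Finset.filter_congr fun S hS => ?_
  rw [Finset.mem_powerset] at hS
  rw [← Finset.image_sdiff _ _ hfi, ← Finset.image_union, ← Finset.image_union, hcell, hcell]

/-- **A free terminal pair** `e = q_k–q_k' ∈ M`: `blockTab {e} ∅ = pairTab k k'`. [this work] -/
theorem blockTab_pair_free (a b c y : Fin n) (hq : Function.Injective (quad a b c y)) (k k' : Fin 4) :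
    blockTab a b c y {s(quad a b c y k, quad a b c y k')} ∅ = pairTab k k' := by
  classical
  have h0 : cellOf a b c y (↑(∅ : Finset (Sym2 (Fin n)))) = 0 := cellOf_empty a b c y hq
  have h1 : cellOf a b c y (↑({s(quad a b c y k, quad a b c y k')} : Finset (Sym2 (Fin n)))) = glueCell {k, k'} :=
    cellOf_eq_of_prof_eq (prof_pair a b c y hq k k')
  funext s t
  unfold blockTab pairTab
  rw [Finset.card_filter, ← Finset.insert_empty, Finset.sum_powerset_insert (Finset.notMem_empty _),
    Finset.powerset_empty, Finset.sum_singleton, Finset.sum_singleton, Finset.insert_empty]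
  simp only [Finset.empty_union, Finset.sdiff_empty, sdiff_self, Finset.bot_eq_empty, h0, h1]

/-- **A contracted terminal pair** `e = q_k–q_k' ∈ C`: `blockTab ∅ {e} = starTab {k,k'} ∅`. [this work] -/
theorem blockTab_pair_contracted (a b c y : Fin n) (hq : Function.Injective (quad a b c y)) (k k' : Fin 4) :
    blockTab a b c y ∅ {s(quad a b c y k, quad a b c y k')} = starTab {k, k'} ∅ := by
  classical
  have h1 : cellOf a b c y (↑({s(quad a b c y k, quad a b c y k')} : Finset (Sym2 (Fin n)))) = glueCell {k, k'} :=
    cellOf_eq_of_prof_eq (prof_pair a b c y hq k k')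
  funext s t
  rw [starTab_empty]
  unfold blockTab
  rw [Finset.powerset_empty, Finset.filter_singleton]
  simp only [Finset.union_empty, Finset.sdiff_empty, h1]
  split_ifs <;> simp

/-- A VC pair containing an internal vertex `v` has label `{v}`. [this work] -/
theorem vcBlk_eq_singleton_of_mem (a b c y : Fin n) {e : Sym2 (Fin n)} (he : (∃ v : Fin n, ∃ k : Fin 4, (∀ j, quad a b c y j ≠ v) ∧ e = s(v, quad a b c y k)) ∨
      ∃ k k' : Fin 4, e = s(quad a b c y k, quad a b c y k')) {v : Fin n} (hve : v ∈ e)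
    (hv : ∀ k, quad a b c y k ≠ v) : vcBlk a b c y e = {v} := by
  rcases he with ⟨v₁, k, hv₁, rfl⟩ | ⟨k, k', rfl⟩
  · rcases Sym2.mem_iff.1 hve with h | h
    · rw [vcBlk_star a b c y hv₁ k, h]
    · exact absurd h.symm (hv k)
  · rcases Sym2.mem_iff.1 hve with h | h
    · exact absurd h.symm (hv k)
    · exact absurd h.symm (hv k')

/-- VC pairs with different labels share only terminal vertices. [this work] -/
theorem vc_sep (a b c y : Fin n) {S : Finset (Sym2 (Fin n))} (hS : ∀ e ∈ S, (∃ v : Fin n, ∃ k : Fin 4, (∀ j, quad a b c y j ≠ v) ∧ e = s(v, quad a b c y k)) ∨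
      ∃ k k' : Fin 4, e = s(quad a b c y k, quad a b c y k')) :
    ∀ e ∈ S, ∀ e' ∈ S, vcBlk a b c y e ≠ vcBlk a b c y e' → ∀ v : Fin n, v ∈ e → v ∈ e' → ∃ k, quad a b c y k = v := by
  intro e he e' he' hne v hv hv'
  by_contra hnt
  push Not at hnt
  exact hne ((vcBlk_eq_singleton_of_mem a b c y (hS e he) hv hnt).trans
    (vcBlk_eq_singleton_of_mem a b c y (hS e' he') hv' hnt).symm)

/-- The block of label `{v}` (`v` internal) inside a set of VC pairs is the star of `v`. [this work] -/
theorem filter_vcBlk_star (a b c y : Fin n) {S : Finset (Sym2 (Fin n))} (hS : ∀ e ∈ S, (∃ v : Fin n, ∃ k : Fin 4, (∀ j, quad a b c y j ≠ v) ∧ e = s(v, quad a b c y k)) ∨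
      ∃ k k' : Fin 4, e = s(quad a b c y k, quad a b c y k')) {v : Fin n}
    (hv : ∀ k, quad a b c y k ≠ v) :
    (S.filter fun e => vcBlk a b c y e = {v}) =
      (Finset.univ.filter fun k : Fin 4 => s(v, quad a b c y k) ∈ S).image fun k => s(v, quad a b c y k) := by
  ext e
  simp only [Finset.mem_filter, Finset.mem_image, Finset.mem_univ, true_and]
  constructor
  · rintro ⟨he, hl⟩
    rcases hS e he with ⟨v₁, k, hv₁, rfl⟩ | ⟨k, k', rfl⟩
    · rw [vcBlk_star a b c y hv₁ k] at hl
      have : v₁ = v := Finset.singleton_injective hl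
      subst this
      exact ⟨k, he, rfl⟩
    · exfalso
      rw [vcBlk_pair] at hl
      have hmem : v ∈ (Finset.univ.filter fun u => u ∈ s(quad a b c y k, quad a b c y k')) := by
        rw [hl]; exact Finset.mem_singleton_self v
      simp only [Finset.mem_filter, Finset.mem_univ, true_and, Sym2.mem_iff] at hmem
      rcases hmem with h | h
      · exact hv k h.symm
      · exact hv k' h.symm
  · rintro ⟨k, hk, rfl⟩
    exact ⟨hk, vcBlk_star a b c y hv k⟩

/-- The block of the label of a terminal pair `e₀` inside a set of VC pairs is `{e₀} ∩ S`. [this work] -/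
theorem filter_vcBlk_pair (a b c y : Fin n) {S : Finset (Sym2 (Fin n))} (hS : ∀ e ∈ S, (∃ v : Fin n, ∃ k : Fin 4, (∀ j, quad a b c y j ≠ v) ∧ e = s(v, quad a b c y k)) ∨
      ∃ k k' : Fin 4, e = s(quad a b c y k, quad a b c y k')) (k k' : Fin 4) :
    (S.filter fun e => vcBlk a b c y e = vcBlk a b c y s(quad a b c y k, quad a b c y k')) =
      S.filter fun e => e = s(quad a b c y k, quad a b c y k') := by
  refine Finset.filter_congr fun e he => ⟨fun hl => ?_, fun hl => by rw [hl]⟩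
  rcases hS e he with ⟨v₁, j, hv₁, rfl⟩ | ⟨j, j', rfl⟩
  · exfalso
    rw [vcBlk_star a b c y hv₁ j, vcBlk_pair] at hl
    have hmem : v₁ ∈ (Finset.univ.filter fun u => u ∈ s(quad a b c y k, quad a b c y k')) := by
      rw [← hl]; exact Finset.mem_singleton_self v₁
    simp only [Finset.mem_filter, Finset.mem_univ, true_and, Sym2.mem_iff] at hmem
    rcases hmem with h | h
    · exact hv₁ k h.symm
    · exact hv₁ k' h.symm
  · rw [vcBlk_pair, vcBlk_pair] at hl
    apply Sym2.ext
    intro u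
    have := congrArg (fun T : Finset (Fin n) => u ∈ T) hl
    simpa using this

/-- **Every block table of a VC fibre is a star table or a free terminal-pair table**, hence "good" whenever those are.
[this work] -/
theorem vc_block_good (a b c y : Fin n) (hq : Function.Injective (quad a b c y)) (good : Table → Prop)
    (hstar : ∀ A F : Finset (Fin 4), Disjoint A F → good (starTab A F))
    (hpair : ∀ k k' : Fin 4, k ≠ k' → good (pairTab k k'))
    (M C : Finset (Sym2 (Fin n))) (hCM : Disjoint C M) (hMC : ∀ e ∈ M ∪ C, (∃ v : Fin n, ∃ k : Fin 4, (∀ j, quad a b c y j ≠ v) ∧ e = s(v, quad a b c y k)) ∨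
      ∃ k k' : Fin 4, e = s(quad a b c y k, quad a b c y k'))
    (l : Finset (Fin n)) (hl : l ∈ (M ∪ C).image (vcBlk a b c y)) :
    good (blockTab a b c y (M.filter fun e => vcBlk a b c y e = l) (C.filter fun e => vcBlk a b c y e = l)) := by
  classical
  have hM := fun e (he : e ∈ M) => hMC e (Finset.mem_union_left _ he)
  have hC := fun e (he : e ∈ C) => hMC e (Finset.mem_union_right _ he)
  obtain ⟨e₀, he₀, rfl⟩ := Finset.mem_image.1 hl
  rcases hMC e₀ he₀ with ⟨v, k, hv, rfl⟩ | ⟨k, k', rfl⟩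
  · -- the star of the internal vertex `v`
    rw [vcBlk_star a b c y hv k, filter_vcBlk_star a b c y hM hv, filter_vcBlk_star a b c y hC hv,
      blockTab_star a b c y hq v hv]
    refine hstar _ _ (Finset.disjoint_left.2 fun j hjC hjM => ?_)
    simp only [Finset.mem_filter, Finset.mem_univ, true_and] at hjC hjM
    exact Finset.disjoint_left.1 hCM hjC hjM
  · -- a terminal pair (or loop), free or contracted
    rw [filter_vcBlk_pair a b c y hM k k', filter_vcBlk_pair a b c y hC k k', Finset.filter_eq', Finset.filter_eq']
    rcases Finset.mem_union.1 he₀ with heM | heC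
    · have heC : s(quad a b c y k, quad a b c y k') ∉ C := fun h => Finset.disjoint_left.1 hCM h heM
      rw [if_pos heM, if_neg heC, blockTab_pair_free a b c y hq k k']
      by_cases hkk : k = k'
      · subst hkk
        have h := pairTab_self k
        rw [show pairTab k k = starTab ∅ {k} from funext fun s => funext fun t => h s t]
        exact hstar ∅ {k} (Finset.disjoint_empty_left _)
      · exact hpair k k' hkk
    · have heM : s(quad a b c y k, quad a b c y k') ∉ M := fun h => Finset.disjoint_left.1 hCM heC h
      rw [if_neg heM, if_pos heC, blockTab_pair_contracted a b c y hq k k']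
      exact hstar _ _ (Finset.disjoint_empty_right _)

/-- **Law-level bridge for the vertex-cover class (generic kernel).**  Let `K` be a kernel such that every list of "good"
tables acting on `K` has a nonnegative `(⊥,⊥)` entry, where all star tables `starTab A F` (`A ∩ F = ∅`) and all free terminal-pair
tables `pairTab k k'` (`k ≠ k'`) are good.  Then for every finite weighted graph whose weight vanishes on all pairs of NON-TERMINAL
vertices (the non-terminals are pairwise non-adjacent = the terminals form a vertex cover of the support) and all pairwise distinct
marked points `a b c y`: `0 ≤ Σ_{i,j} K i j · cell i · cell j`. [this work] -/
theorem sum_kernel_cell_nonneg_of_vertexCover (a b c y : Fin n) (hq : Function.Injective (quad a b c y)) (K : Ker)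
    (good : Table → Prop) (hgood : ∀ Gs : List Table, (∀ G ∈ Gs, good G) → 0 ≤ tactList Gs K 0 0)
    (hstar : ∀ A F : Finset (Fin 4), Disjoint A F → good (starTab A F))
    (hpair : ∀ k k' : Fin 4, k ≠ k' → good (pairTab k k'))
    (w : Sym2 (Fin n) → unitInterval)
    (hVC : ∀ u v : Fin n, (∀ k, quad a b c y k ≠ u) → (∀ k, quad a b c y k ≠ v) → (w s(u, v) : ℝ) = 0) :
    0 ≤ ∑ i : Fin 15, ∑ j : Fin 15, (K i j : ℝ) * cell w a b c y i * cell w a b c y j := by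
  classical
  apply sum_kernel_cell_nonneg_of_supported_fibres a b c y w
  intro M C hCM hsupp
  -- every supported pair is a VC pair
  have hMC : ∀ e ∈ M ∪ C, (∃ v : Fin n, ∃ k : Fin 4, (∀ j, quad a b c y j ≠ v) ∧ e = s(v, quad a b c y k)) ∨
      ∃ k k' : Fin 4, e = s(quad a b c y k, quad a b c y k') := by
    intro e he
    have hw : (w e : ℝ) ≠ 0 := hsupp e (by rwa [Finset.union_comm] at he)
    obtain ⟨u, v, rfl⟩ := sym2_exists_eq e
    by_cases hu : ∀ k, quad a b c y k ≠ u
    · by_cases hv : ∀ k, quad a b c y k ≠ v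
      · exact absurd (hVC u v hu hv) hw
      · push Not at hv
        obtain ⟨k, hk⟩ := hv
        exact Or.inl ⟨u, k, hu, by rw [hk]⟩
    · push Not at hu
      obtain ⟨k, hk⟩ := hu
      by_cases hv : ∀ j, quad a b c y j ≠ v
      · exact Or.inl ⟨v, k, hv, by rw [hk, Sym2.eq_swap]⟩
      · push Not at hv
        obtain ⟨k', hk'⟩ := hv
        exact Or.inr ⟨k, k', by rw [hk, hk']⟩
  have hL : ∀ T ∈ M.powerset, liftK K (prof a b c y ↑(C ∪ T)) (prof a b c y ↑(C ∪ (M \ T))) =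
      K (cellOf a b c y ↑(C ∪ T)) (cellOf a b c y ↑(C ∪ (M \ T))) := fun T _ => liftK_prof K a b c y _ _
  rw [Finset.sum_congr rfl hL]
  rw [fibre_factor a b c y (vcBlk a b c y) ((M ∪ C).image (vcBlk a b c y)).toList K M C (Finset.nodup_toList _)
    (fun e he => Finset.mem_toList.2 (Finset.mem_image_of_mem _ he)) (vc_sep a b c y hMC), cellOf_empty a b c y hq]
  refine hgood _ fun G hG => ?_
  obtain ⟨l, hl, rfl⟩ := List.mem_map.1 hG
  exact vc_block_good a b c y hq good hstar hpair M C hCM hMC l (Finset.mem_toList.1 hl)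

end VCCone

end Summit.CriticalPhenomena.PercolationContinuityZ3.Theorems
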